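import Summits.AtomisticToContinuum.FouriersLaw.Theorems.RobinCoercivity.Negative.SchurPositivity
import Summits.AtomisticToContinuum.FouriersLaw.Theorems.RobinCoercivity.Negative.WithoutCoupling
import Summits.AtomisticToContinuum.FouriersLaw.Theorems.HonestZwanzigParityStatics
import Summits.AtomisticToContinuum.FouriersLaw.Theorems.HonestZwanzigRobinCoercivityStubFeshbachIdentities

/-!
# `HonestZwanzig.RobinCoercivity` (crux stmt-AtomisticToContinuum-12695) — negative lemmas, part 2: the contact ceiling

Refuter / crux-disprover support file (`--supports stmt-AtomisticToContinuum-12695`). For the Feshbach matrix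
`𝔽_N(s)_{xy} = s·Cov(e_x,e_y) − Cov(e_x, L e_y) − schur_s(L†e_x, L e_y)` of route `HonestZwanzig`, tested on the
CONSTANT profile `ξ ≡ 1` (total energy `H = Σ_x e_x`, `L H = L†H = w := γ(T − p_0²) + γ(T − p_{N−1}²)`):

* `sum_sum_feshbach_le` / `one_feshbach_one_le` — **`1ᵀ𝔽_N(s)1 ≤ s·1ᵀCov(e,e)1 + 2γT²`** for every `N ≥ 2` and EVERY
  `s > 0`: against the total energy the Feshbach matrix is at most Newton cooling at the two contacts (`ParityStatics`) plus
  the vanishing static term, because the memory term `schur_s(w,w)` is nonnegative (part 1) and enters with a minus sign;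
* `robinBody_const_le`, `robinConst_le_contact`, `robinCoercivity_const_le` (`RobinBody`, `RobinCoercivityAt` as in
  `…Negative.WithoutCoupling`) — hence every constant `c` admissible in
  `RobinCoercivity` at `(ω₂, lam, β, γ, T)` obeys **`c ≤ γT²`**: the Robin constant never beats the bare contact
  conductance (TIGHTNESS; numerically — compute job j016689, exact Gaussian algebra at the harmonic point — the
  renormalised contact conductance `1ᵀ𝔽_N(0⁺)1/2` is `0.904 γT²` at `γ = T = ω₂ = 1` but `0.015 γT²` at `γ = 25`);
* REFUTED NATURAL STRENGTHENINGS: `not_robinCoercivityUniformInT` (no `T`-uniform constant),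
  `not_robinCoercivityUniformInCoupling` (no constant uniform as `γ ↓ 0`), `not_uniformL2Ellipticity` (`𝔽_N(s) ≥ c·Id`
  uniformly in `N` is false: `c ≤ 2γT²/N`; the crux's Robin normalisation is the right one).

The main statements carry the route's fixed-`N` support item `FeshbachIdentities` (stmt-AtomisticToContinuum-12697) as a
hypothesis, exactly as the lead's skeleton `Lines/LinAlg.lean`; since the lead has LANDED it
(`Robin.stub_feshbachIdentities`), the primed versions at the end of the file are UNCONDITIONAL. Uses the landed
`generatorSiteEnergy_proof`, `parityStatics_proof`.
-/

noncomputable section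

open MeasureTheory Finset Matrix
open Literature.MathematicalPhysics.KineticTheory.HeatConduction
open Summit.AtomisticToContinuum.FouriersLaw.Theses.HonestZwanzig
open Summit.AtomisticToContinuum.FouriersLaw.Theorems.HonestZwanzig
open Summit.AtomisticToContinuum.FouriersLaw.Theorems.HonestZwanzig.NetworkReduction

namespace Summit.AtomisticToContinuum.FouriersLaw.Theorems.RobinCoercivity.Negative

/-! ### Fixed `N`, fixed `s` (gadgets as in part 1) -/

section FixedN

variable {ω₂ lam β γ : ℝ} {N : ℕ} {T : ℝ}
  {Adm : (PhaseSpace N → ℝ) → Prop}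
  {corr : (PhaseSpace N → ℝ) → (PhaseSpace N → ℝ) → ℝ → ℝ}
  {lap : ℝ → (PhaseSpace N → ℝ) → (PhaseSpace N → ℝ) → ℝ}
  {cov : (PhaseSpace N → ℝ) → (PhaseSpace N → ℝ) → ℝ}
  {e : Fin N → PhaseSpace N → ℝ}
  (hAdm : ∀ f, Adm f ↔ (Continuous f ∧ ∃ A : ℝ, ∀ z,
    |f z| ≤ A * Real.exp ((pinnedChain ω₂ lam β γ).hamiltonian N z / (8 * T))))
  (hcorr : ∀ f g t, corr f g t =
    (∫ z, f z * (∫ y, g y ∂((pinnedChain ω₂ lam β γ).transitionKernel N T T t.toNNReal z))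
      ∂(pinnedChain ω₂ lam β γ).gibbsMeasure N T) -
    (∫ z, f z ∂(pinnedChain ω₂ lam β γ).gibbsMeasure N T) *
      (∫ z, g z ∂(pinnedChain ω₂ lam β γ).gibbsMeasure N T))
  (hlap : ∀ s f g, lap s f g = ∫ t in Set.Ioi (0 : ℝ), Real.exp (-(s * t)) * corr f g t)
  (hcov : ∀ f g, cov f g = (∫ z, f z * g z ∂(pinnedChain ω₂ lam β γ).gibbsMeasure N T) -
    (∫ z, f z ∂(pinnedChain ω₂ lam β γ).gibbsMeasure N T) *
      (∫ z, g z ∂(pinnedChain ω₂ lam β γ).gibbsMeasure N T))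
  (he : ∀ x z, e x z = z.2 x ^ 2 / 2 + (pinnedChain ω₂ lam β γ).U (z.1 x) +
    ∑ j : Fin N, ((if j.val = x.val + 1 then (pinnedChain ω₂ lam β γ).V (z.1 j - z.1 x) / 2 else 0) +
      (if x.val = j.val + 1 then (pinnedChain ω₂ lam β γ).V (z.1 x - z.1 j) / 2 else 0)))
  (hFI : ∀ f g : PhaseSpace N → ℝ, Adm f → Adm g →
    Integrable f ((pinnedChain ω₂ lam β γ).gibbsMeasure N T) ∧
    (∀ t : ℝ, 0 ≤ t → Integrable (fun z => f z *
      (∫ y, g y ∂((pinnedChain ω₂ lam β γ).transitionKernel N T T t.toNNReal z)))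
      ((pinnedChain ω₂ lam β γ).gibbsMeasure N T)) ∧
    IntegrableOn (corr f g) (Set.Ioi 0) ∧
    (∀ t : ℝ, 0 ≤ t → corr f g t = corr (fun z => g (z.1, -z.2)) (fun z => f (z.1, -z.2)) t) ∧
    (∀ s : ℝ, 0 < s → ∀ x : Fin N,
      s * lap s (e x) g - cov (e x) g =
        lap s (fun z => (pinnedChain ω₂ lam β γ).generator N T T (e x) (z.1, -z.2)) g ∧
      s * lap s f (e x) - cov f (e x) = lap s f ((pinnedChain ω₂ lam β γ).generator N T T (e x))))
  (hGSE : ∀ (x : Fin N) (z : PhaseSpace N), (pinnedChain ω₂ lam β γ).generator N T T (e x) z =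
    (∑ b : Fin N, ((if x.val = b.val + 1 then (pinnedChain ω₂ lam β γ).bondCurrent N b z else 0) -
      (if b = x then (pinnedChain ω₂ lam β γ).bondCurrent N b z else 0))) +
    (if x.val = 0 then (pinnedChain ω₂ lam β γ).γ * (T - z.2 x ^ 2) else 0) +
    (if x.val = N - 1 then (pinnedChain ω₂ lam β γ).γ * (T - z.2 x ^ 2) else 0))
  (hPS : ∀ x y : Fin N, cov (e x) ((pinnedChain ω₂ lam β γ).generator N T T (e y)) =
    -(if x = y ∧ (x.val = 0 ∨ x.val = N - 1) then (pinnedChain ω₂ lam β γ).γ * T ^ 2 else 0))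
  (hω : 0 < ω₂) (hl : 0 ≤ lam) (hβ : 0 ≤ β) (hγ : 0 ≤ γ) (hT : 0 < T)

include hGSE in
/-- The generator images of the split site energies telescope to the bath heating terms:
`Σ_x (L e_x)(z) = γ(T − p_0²) + γ(T − p_{N−1}²)` (`N ≥ 2`; the last bond carries no current). -/
theorem sum_generator_splitSite (hN : 2 ≤ N) (z : PhaseSpace N) :
    ∑ x, (pinnedChain ω₂ lam β γ).generator N T T (e x) z =
      (pinnedChain ω₂ lam β γ).γ * (T - z.2 ⟨0, by omega⟩ ^ 2) +
        (pinnedChain ω₂ lam β γ).γ * (T - z.2 ⟨N - 1, by omega⟩ ^ 2) := by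
  simp only [hGSE, Finset.sum_add_distrib, Finset.sum_sub_distrib]
  have h1 : ∑ x : Fin N, ∑ b : Fin N,
      (if x.val = b.val + 1 then (pinnedChain ω₂ lam β γ).bondCurrent N b z else 0) =
      ∑ b : Fin N, (pinnedChain ω₂ lam β γ).bondCurrent N b z := by
    rw [Finset.sum_comm]
    refine Finset.sum_congr rfl fun b _ => ?_
    by_cases hb : b.val + 1 < N
    · exact sum_ite_succ_eq (fun _ => (pinnedChain ω₂ lam β γ).bondCurrent N b z) b hb
    · rw [sum_ite_succ_eq_zero (fun _ => (pinnedChain ω₂ lam β γ).bondCurrent N b z) b hb,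
        bondCurrent_eq_zero_of_last _ b hb z]
  have h2 : ∑ x : Fin N, ∑ b : Fin N, (if b = x then (pinnedChain ω₂ lam β γ).bondCurrent N b z else 0) =
      ∑ b : Fin N, (pinnedChain ω₂ lam β γ).bondCurrent N b z := by
    rw [Finset.sum_comm]
    refine Finset.sum_congr rfl fun b _ => ?_
    rw [Finset.sum_ite_eq]
    simp
  rw [h1, h2, sub_self, zero_add,
    sum_ite_val_eq 0 (by omega) (fun x => (pinnedChain ω₂ lam β γ).γ * (T - z.2 x ^ 2)),
    sum_ite_val_eq (N - 1) (by omega) (fun x => (pinnedChain ω₂ lam β γ).γ * (T - z.2 x ^ 2))]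

include hPS in
/-- The static block against the constant profile: `Σ_x Σ_y Cov(e_x, L e_y) = −2γT²` (`ParityStatics`, `N ≥ 2`). -/
theorem sum_sum_cov_generator (hN : 2 ≤ N) :
    ∑ x, ∑ y, cov (e x) ((pinnedChain ω₂ lam β γ).generator N T T (e y)) =
      -(2 * ((pinnedChain ω₂ lam β γ).γ * T ^ 2)) := by
  simp only [hPS]
  have h1 : ∀ x : Fin N, ∑ y : Fin N,
      -(if x = y ∧ (x.val = 0 ∨ x.val = N - 1) then (pinnedChain ω₂ lam β γ).γ * T ^ 2 else 0) =
      -((if x.val = 0 then (pinnedChain ω₂ lam β γ).γ * T ^ 2 else 0) +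
        (if x.val = N - 1 then (pinnedChain ω₂ lam β γ).γ * T ^ 2 else 0)) := by
    intro x
    rw [Finset.sum_neg_distrib, Finset.sum_eq_single x]
    · congr 1
      have hx := x.isLt
      by_cases h0 : x.val = 0
      · have h1 : ¬ x.val = N - 1 := by omega
        rw [if_pos ⟨rfl, Or.inl h0⟩, if_pos h0, if_neg h1, add_zero]
      · by_cases h1 : x.val = N - 1
        · rw [if_pos ⟨rfl, Or.inr h1⟩, if_neg h0, if_pos h1, zero_add]
        · rw [if_neg (fun h => h.2.elim h0 h1), if_neg h0, if_neg h1, add_zero]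
    · intro y _ hyx
      rw [if_neg (fun h => hyx h.1.symm)]
    · intro h
      exact absurd (Finset.mem_univ x) h
  simp only [h1, Finset.sum_neg_distrib, Finset.sum_add_distrib]
  rw [sum_ite_val_eq 0 (by omega) (fun _ => (pinnedChain ω₂ lam β γ).γ * T ^ 2),
    sum_ite_val_eq (N - 1) (by omega) (fun _ => (pinnedChain ω₂ lam β γ).γ * T ^ 2)]
  ring

include hAdm hcorr hlap hFI he hGSE hPS hω hl hβ hT in
/-- **The contact ceiling at fixed `N` and `s`.** Under the fixed-`N` package, for `N ≥ 2`, `s > 0`, `β, γ > 0` and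
`G(s)` with positive quadratic form: `Σ_x Σ_y 𝔽_N(s)_{xy} ≤ s·Σ_x Σ_y Cov(e_x,e_y) + 2γT²` — against the total energy the
memory term `schur_s(L†H, LH) = schur_s(w, w)`, `w = γ(T − p_0²) + γ(T − p_{N−1}²)`, is nonnegative. -/
theorem sum_sum_feshbach_le (hβ' : 0 < β) (hγ' : 0 < γ) (hN : 2 ≤ N) {s : ℝ} (hs : 0 < s)
    (G : Matrix (Fin N) (Fin N) ℝ) (hG : ∀ x y, G x y = lap s (e x) (e y))
    (hGp : ∀ v : Fin N → ℝ, v ≠ 0 → 0 < ∑ x, ∑ y, v x * G x y * v y)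
    (schur : (PhaseSpace N → ℝ) → (PhaseSpace N → ℝ) → ℝ)
    (hschur : ∀ f g, schur f g = lap s f g - ∑ u, ∑ v, lap s f (e u) * G⁻¹ u v * lap s (e v) g)
    (F : Fin N → Fin N → ℝ)
    (hF : ∀ x y, F x y = s * cov (e x) (e y) - cov (e x) ((pinnedChain ω₂ lam β γ).generator N T T (e y)) -
      schur (fun z => (pinnedChain ω₂ lam β γ).generator N T T (e x) (z.1, -z.2))
        ((pinnedChain ω₂ lam β γ).generator N T T (e y))) :
    ∑ x, ∑ y, F x y ≤ s * (∑ x, ∑ y, cov (e x) (e y)) + 2 * ((pinnedChain ω₂ lam β γ).γ * T ^ 2) := by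
  have hN0 : 0 < N := by omega
  have hLf : ∀ x, Adm ((pinnedChain ω₂ lam β γ).generator N T T (e x)) :=
    fun x => adm_generator_e hAdm hGSE hω hl hβ hT x
  have hLr : ∀ x, Adm (fun z => (pinnedChain ω₂ lam β γ).generator N T T (e x) (z.1, -z.2)) :=
    fun x => adm_rev Adm hAdm (hLf x)
  -- the bath heating observable `w`
  set w : PhaseSpace N → ℝ := fun z => (pinnedChain ω₂ lam β γ).γ * (T - z.2 ⟨0, by omega⟩ ^ 2) +
    (pinnedChain ω₂ lam β γ).γ * (T - z.2 ⟨N - 1, by omega⟩ ^ 2) with hw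
  have hw_adm : Adm w :=
    adm_add Adm hAdm
      (adm_const_mul Adm hAdm _ (adm_sub Adm hAdm (adm_const Adm hAdm hω hl hβ hT T) (adm_psq Adm hAdm hω hl hβ hT _)))
      (adm_const_mul Adm hAdm _ (adm_sub Adm hAdm (adm_const Adm hAdm hω hl hβ hT T) (adm_psq Adm hAdm hω hl hβ hT _)))
  have hgsum : (fun z => ∑ y, (pinnedChain ω₂ lam β γ).generator N T T (e y) z) = w :=
    funext fun z => sum_generator_splitSite hGSE hN z
  have hfsum : (fun z => ∑ x, (pinnedChain ω₂ lam β γ).generator N T T (e x) (z.1, -z.2)) = w := by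
    funext z
    rw [sum_generator_splitSite hGSE hN (z.1, -z.2), hw]
    simp only [Pi.neg_apply, neg_sq]
  -- the three blocks
  have hschurSum : ∑ x, ∑ y, schur (fun z => (pinnedChain ω₂ lam β γ).generator N T T (e x) (z.1, -z.2))
      ((pinnedChain ω₂ lam β γ).generator N T T (e y)) = schur w w := by
    rw [sum_sum_schur_eq_schur_sum hAdm hcorr hlap he hFI hω hl hβ hT hs.le G schur hschur Finset.univ Finset.univ
      (fun x z => (pinnedChain ω₂ lam β γ).generator N T T (e x) (z.1, -z.2))
      (fun y => (pinnedChain ω₂ lam β γ).generator N T T (e y)) (fun x _ => hLr x) (fun y _ => hLf y)]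
    rw [hfsum]
    exact congrArg _ hgsum
  have hnonneg : 0 ≤ schur w w :=
    schur_self_nonneg hAdm hcorr hlap he hFI hω hl hβ hT hβ' hγ' hN0 hs G hG hGp schur hschur hw_adm
  have hcovSum := sum_sum_cov_generator (cov := cov) (e := e) hPS hN
  simp only [hF, Finset.sum_sub_distrib]
  rw [hschurSum, hcovSum]
  have hmul : ∑ x, ∑ y, s * cov (e x) (e y) = s * ∑ x, ∑ y, cov (e x) (e y) := by
    rw [Finset.mul_sum]
    exact Finset.sum_congr rfl fun x _ => by rw [Finset.mul_sum]
  rw [hmul]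
  linarith

end FixedN

/-! ### At the route's objects (`RobinBody`, `RobinCoercivityAt` from `…Negative.WithoutCoupling`) -/

/-- **The contact ceiling** (modulo the route's support item `FeshbachIdentities`): for all positive parameters, `T > 0`,
`N ≥ 2` and EVERY `s > 0`, `1ᵀ𝔽_N(s)1 = Σ_x Σ_y 𝔽_N(s)_{xy} ≤ s·Σ_x Σ_y Cov(e_x,e_y) + 2γT²`. -/
theorem one_feshbach_one_le (hFI : FeshbachIdentities) :
    ∀ ω₂ lam β γ : ℝ, 0 < ω₂ → 0 < lam → 0 < β → 0 < γ → ∀ T : ℝ, 0 < T → ∀ N : ℕ, 2 ≤ N →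
    let P := Literature.MathematicalPhysics.KineticTheory.HeatConduction.pinnedChain ω₂ lam β γ;
    let X := Literature.MathematicalPhysics.KineticTheory.HeatConduction.PhaseSpace N;
    let μ : MeasureTheory.Measure X := P.gibbsMeasure N T;
    let corr : (X → ℝ) → (X → ℝ) → ℝ → ℝ := fun f g t => (∫ z, f z * (∫ y, g y ∂(P.transitionKernel N T T t.toNNReal z)) ∂μ) - (∫ z, f z ∂μ) * (∫ z, g z ∂μ);
    let lap : ℝ → (X → ℝ) → (X → ℝ) → ℝ := fun s f g => ∫ t in Set.Ioi (0 : ℝ), Real.exp (-(s * t)) * corr f g t;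
    let cov : (X → ℝ) → (X → ℝ) → ℝ := fun f g => (∫ z, f z * g z ∂μ) - (∫ z, f z ∂μ) * (∫ z, g z ∂μ);
    let e : Fin N → X → ℝ := fun x z => z.2 x ^ 2 / 2 + P.U (z.1 x) + ∑ j : Fin N, ((if j.val = x.val + 1 then P.V (z.1 j - z.1 x) / 2 else 0) + (if x.val = j.val + 1 then P.V (z.1 x - z.1 j) / 2 else 0));
    let G : ℝ → Matrix (Fin N) (Fin N) ℝ := fun s => Matrix.of fun x y => lap s (e x) (e y);
    let schur : ℝ → (X → ℝ) → (X → ℝ) → ℝ := fun s f g => lap s f g - ∑ x : Fin N, ∑ y : Fin N, lap s f (e x) * (G s)⁻¹ x y * lap s (e y) g;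
    let F : ℝ → Fin N → Fin N → ℝ := fun s x y => s * cov (e x) (e y) - cov (e x) (P.generator N T T (e y)) - schur s (fun z => P.generator N T T (e x) (z.1, -z.2)) (P.generator N T T (e y));
    ∀ s : ℝ, 0 < s → ∑ x : Fin N, ∑ y : Fin N, F s x y ≤ s * (∑ x : Fin N, ∑ y : Fin N, cov (e x) (e y)) + 2 * (γ * T ^ 2) := by
  intro ω₂ lam β γ hω hl hβ hγ T hT N hN
  dsimp only
  intro s hs
  obtain ⟨-, hFI2, -, hGp⟩ := hFI ω₂ lam β γ hω hl hβ hγ T hT N hN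
  exact sum_sum_feshbach_le (ω₂ := ω₂) (lam := lam) (β := β) (γ := γ) (N := N) (T := T)
    (corr := fun f g t => (∫ z, f z * (∫ y, g y ∂((pinnedChain ω₂ lam β γ).transitionKernel N T T
      t.toNNReal z)) ∂(pinnedChain ω₂ lam β γ).gibbsMeasure N T) -
      (∫ z, f z ∂(pinnedChain ω₂ lam β γ).gibbsMeasure N T) * (∫ z, g z ∂(pinnedChain ω₂ lam β γ).gibbsMeasure N T))
    (cov := fun f g => (∫ z, f z * g z ∂(pinnedChain ω₂ lam β γ).gibbsMeasure N T) -
      (∫ z, f z ∂(pinnedChain ω₂ lam β γ).gibbsMeasure N T) * (∫ z, g z ∂(pinnedChain ω₂ lam β γ).gibbsMeasure N T))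
    (fun f => Iff.rfl) (fun f g t => rfl) (fun s f g => rfl) (fun x z => rfl)
    hFI2 (fun x z => generatorSiteEnergy_proof ω₂ lam β γ N hN T T x z)
    (fun x y => ((parityStatics_proof ω₂ lam β γ hω hl hβ hγ T hT N hN) x).2 y)
    hω hl.le hβ.le hT hβ hγ hN hs _ (fun x y => rfl) (hGp s hs) _ (fun f g => rfl) _ (fun x y => rfl)

/-- **Tightness of the constant**: every `c` admissible in `RobinCoercivity` at `(ω₂, lam, β, γ, T)` and some `N ≥ 2`
satisfies `c ≤ γT²` — the Robin constant never exceeds the bare contact conductance (test profile `ξ ≡ 1`, `s ↓ 0`). -/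
theorem robinBody_const_le (hFI : FeshbachIdentities) {ω₂ lam β γ T c : ℝ} {N : ℕ} {s₀ : ℝ} (hω : 0 < ω₂)
    (hl : 0 < lam) (hβ : 0 < β) (hγ : 0 < γ) (hT : 0 < T) (hN : 2 ≤ N) (hs₀ : 0 < s₀)
    (hbody : RobinBody ω₂ lam β γ T c N s₀) : c ≤ γ * T ^ 2 := by
  have key := one_feshbach_one_le hFI ω₂ lam β γ hω hl hβ hγ T hT N hN
  dsimp only [RobinBody] at hbody key
  have h2c : 2 * c ≤ 2 * (γ * T ^ 2) :=
    le_of_forall_small hs₀ ⟨_, fun s hs hss => by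
      have h1 := hbody s hs hss (fun _ => 1)
      simp only [sub_self, ne_eq, OfNat.ofNat_ne_zero, not_false_eq_true, zero_pow, ite_self,
        Finset.sum_const_zero, zero_add, one_pow, one_mul, mul_one] at h1
      rw [sum_boundary_indicator hN] at h1
      rw [mul_comm]
      exact h1.trans (key s hs)⟩
  linarith

/-- Every constant admissible in `RobinCoercivity` at `(ω₂, lam, β, γ, T)` is at most `γT²`. -/
theorem robinConst_le_contact (hFI : FeshbachIdentities) {ω₂ lam β γ T c : ℝ} (hω : 0 < ω₂) (hl : 0 < lam)
    (hβ : 0 < β) (hγ : 0 < γ) (hT : 0 < T) (h : RobinCoercivityAt ω₂ lam β γ T c) : c ≤ γ * T ^ 2 := by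
  obtain ⟨s₀, hs₀, hbody⟩ := h 2 le_rfl
  exact robinBody_const_le hFI hω hl hβ hγ hT le_rfl hs₀ hbody

/-- Hence the crux pins its constant below the contact conductance: `RobinCoercivity` can only hold with `c ≤ γT²`. -/
theorem robinCoercivity_const_le (hFI : FeshbachIdentities) (hRC : RobinCoercivity) {ω₂ lam β γ T : ℝ}
    (hω : 0 < ω₂) (hl : 0 < lam) (hβ : 0 < β) (hγ : 0 < γ) (hT : 0 < T) :
    ∃ c : ℝ, 0 < c ∧ c ≤ γ * T ^ 2 ∧ RobinCoercivityAt ω₂ lam β γ T c := by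
  obtain ⟨c, hc, h⟩ := (robinCoercivity_iff.mp hRC) ω₂ lam β γ hω hl hβ hγ T hT
  exact ⟨c, hc, robinConst_le_contact hFI hω hl hβ hγ hT h, h⟩

/-! ### Refuted natural strengthenings -/

/-- NATURAL STRENGTHENING 1 (refuted below): a Robin constant UNIFORM IN THE TEMPERATURE. -/
def RobinCoercivityUniformInT : Prop :=
  ∀ ω₂ lam β γ : ℝ, 0 < ω₂ → 0 < lam → 0 < β → 0 < γ → ∃ c : ℝ, 0 < c ∧ ∀ T : ℝ, 0 < T →
    RobinCoercivityAt ω₂ lam β γ T c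

/-- **No `T`-uniform Robin constant** (modulo `FeshbachIdentities`): `c ≤ γT² → 0` as `T ↓ 0`. -/
theorem not_robinCoercivityUniformInT (hFI : FeshbachIdentities) : ¬ RobinCoercivityUniformInT := by
  intro h
  obtain ⟨c, hc, hcT⟩ := h 1 1 1 1 one_pos one_pos one_pos one_pos
  set T : ℝ := min 1 (c / 2) with hTdef
  have hT0 : 0 < T := lt_min one_pos (by linarith)
  have hT1 : T ≤ 1 := min_le_left _ _
  have hT2 : T ≤ c / 2 := min_le_right _ _
  have hle := robinConst_le_contact hFI one_pos one_pos one_pos one_pos hT0 (hcT T hT0)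
  nlinarith

/-- NATURAL STRENGTHENING 2 (refuted below): a Robin constant UNIFORM IN THE BATH COUPLING `γ`. -/
def RobinCoercivityUniformInCoupling : Prop :=
  ∀ ω₂ lam β T : ℝ, 0 < ω₂ → 0 < lam → 0 < β → 0 < T → ∃ c : ℝ, 0 < c ∧ ∀ γ : ℝ, 0 < γ →
    RobinCoercivityAt ω₂ lam β γ T c

/-- **No `γ`-uniform Robin constant** (modulo `FeshbachIdentities`): `c ≤ γT² → 0` as `γ ↓ 0` (weak coupling to the
baths makes the contact conductance, hence the Robin constant, vanish). -/
theorem not_robinCoercivityUniformInCoupling (hFI : FeshbachIdentities) : ¬ RobinCoercivityUniformInCoupling := by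
  intro h
  obtain ⟨c, hc, hcγ⟩ := h 1 1 1 1 one_pos one_pos one_pos one_pos
  set γ : ℝ := min 1 (c / 2) with hγdef
  have hγ0 : 0 < γ := lt_min one_pos (by linarith)
  have hγ2 : γ ≤ c / 2 := min_le_right _ _
  have hle := robinConst_le_contact hFI one_pos one_pos one_pos hγ0 one_pos (hcγ γ hγ0)
  nlinarith

/-- Plain `ℓ²`-ellipticity of the Feshbach matrix at fixed parameters, constant, length and threshold:
`c Σ_i ξ_i² ≤ ξᵀ𝔽_N(s)ξ` for `0 < s < s₀`. -/
def L2Body (ω₂ lam β γ T c : ℝ) (N : ℕ) (s₀ : ℝ) : Prop :=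
    let P := Literature.MathematicalPhysics.KineticTheory.HeatConduction.pinnedChain ω₂ lam β γ;
    let X := Literature.MathematicalPhysics.KineticTheory.HeatConduction.PhaseSpace N;
    let μ : MeasureTheory.Measure X := P.gibbsMeasure N T;
    let corr : (X → ℝ) → (X → ℝ) → ℝ → ℝ := fun f g t => (∫ z, f z * (∫ y, g y ∂(P.transitionKernel N T T t.toNNReal z)) ∂μ) - (∫ z, f z ∂μ) * (∫ z, g z ∂μ);
    let lap : ℝ → (X → ℝ) → (X → ℝ) → ℝ := fun s f g => ∫ t in Set.Ioi (0 : ℝ), Real.exp (-(s * t)) * corr f g t;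
    let cov : (X → ℝ) → (X → ℝ) → ℝ := fun f g => (∫ z, f z * g z ∂μ) - (∫ z, f z ∂μ) * (∫ z, g z ∂μ);
    let e : Fin N → X → ℝ := fun x z => z.2 x ^ 2 / 2 + P.U (z.1 x) + ∑ j : Fin N, ((if j.val = x.val + 1 then P.V (z.1 j - z.1 x) / 2 else 0) + (if x.val = j.val + 1 then P.V (z.1 x - z.1 j) / 2 else 0));
    let G : ℝ → Matrix (Fin N) (Fin N) ℝ := fun s => Matrix.of fun x y => lap s (e x) (e y);
    let schur : ℝ → (X → ℝ) → (X → ℝ) → ℝ := fun s f g => lap s f g - ∑ x : Fin N, ∑ y : Fin N, lap s f (e x) * (G s)⁻¹ x y * lap s (e y) g;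
    let F : ℝ → Fin N → Fin N → ℝ := fun s x y => s * cov (e x) (e y) - cov (e x) (P.generator N T T (e y)) - schur s (fun z => P.generator N T T (e x) (z.1, -z.2)) (P.generator N T T (e y));
    ∀ s : ℝ, 0 < s → s < s₀ → ∀ ξ : Fin N → ℝ, c * (∑ i : Fin N, ξ i ^ 2) ≤ ∑ x : Fin N, ∑ y : Fin N, ξ x * F s x y * ξ y

/-- NATURAL STRENGTHENING 3 (refuted below): UNIFORM `ℓ²`-ELLIPTICITY `𝔽_N(s) ≥ c·Id` with `c` independent of `N`
(the Robin form of the crux replaced by `Σ_i ξ_i²`). -/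
def UniformL2Ellipticity : Prop :=
  ∀ ω₂ lam β γ : ℝ, 0 < ω₂ → 0 < lam → 0 < β → 0 < γ → ∀ T : ℝ, 0 < T → ∃ c : ℝ, 0 < c ∧ ∀ N : ℕ, 2 ≤ N →
    ∃ s₀ : ℝ, 0 < s₀ ∧ L2Body ω₂ lam β γ T c N s₀

/-- An `ℓ²`-ellipticity constant at length `N` is at most `2γT²/N` (test profile `ξ ≡ 1`). -/
theorem l2Const_le (hFI : FeshbachIdentities) {ω₂ lam β γ T c : ℝ} {N : ℕ} {s₀ : ℝ} (hω : 0 < ω₂)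
    (hl : 0 < lam) (hβ : 0 < β) (hγ : 0 < γ) (hT : 0 < T) (hN : 2 ≤ N) (hs₀ : 0 < s₀)
    (hbody : L2Body ω₂ lam β γ T c N s₀) : c * N ≤ 2 * (γ * T ^ 2) := by
  have key := one_feshbach_one_le hFI ω₂ lam β γ hω hl hβ hγ T hT N hN
  dsimp only [L2Body] at hbody key
  exact le_of_forall_small hs₀ ⟨_, fun s hs hss => by
    have h1 := hbody s hs hss (fun _ => 1)
    simp only [one_pow, Finset.sum_const, Finset.card_univ, Fintype.card_fin, nsmul_eq_mul, one_mul, mul_one] at h1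
    exact h1.trans (key s hs)⟩

/-- **No uniform `ℓ²`-ellipticity** (modulo `FeshbachIdentities`): against `ξ ≡ 1` the Feshbach matrix is at most
`s·1ᵀCov(e,e)1 + 2γT²` while `Σ ξ_i² = N`, so `c ≤ 2γT²/N → 0`. The crux's Robin form (whose constant profile costs
only the two contact terms) is the right normalisation; plain ellipticity uniform in `N` is false. -/
theorem not_uniformL2Ellipticity (hFI : FeshbachIdentities) : ¬ UniformL2Ellipticity := by
  intro h
  obtain ⟨c, hc, hcN⟩ := h 1 1 1 1 one_pos one_pos one_pos one_pos 1 one_pos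
  obtain ⟨N₀, hN₀⟩ := exists_nat_gt (3 / c)
  set N : ℕ := max 2 N₀ with hNdef
  have hN2 : 2 ≤ N := le_max_left _ _
  have hNc : 3 ≤ c * N := by
    have h2 : (N₀ : ℝ) ≤ N := by exact_mod_cast le_max_right 2 N₀
    have h3 : 3 / c ≤ N := hN₀.le.trans h2
    rwa [div_le_iff₀' hc] at h3
  obtain ⟨s₀, hs₀, hbody⟩ := hcN N hN2
  have hle := l2Const_le hFI one_pos one_pos one_pos one_pos one_pos hN2 hs₀ hbody
  linarith

/-! ### Unconditional versions (the package is landed: `HonestZwanzig.Robin.stub_feshbachIdentities`) -/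

section Unconditional

open Summit.AtomisticToContinuum.FouriersLaw.Theorems.HonestZwanzig.Robin

/-- **Every constant admissible in `RobinCoercivity` is at most the bare contact conductance `γT²`** (unconditional). -/
theorem robinConst_le_contact' {ω₂ lam β γ T c : ℝ} (hω : 0 < ω₂) (hl : 0 < lam) (hβ : 0 < β) (hγ : 0 < γ)
    (hT : 0 < T) (h : RobinCoercivityAt ω₂ lam β γ T c) : c ≤ γ * T ^ 2 :=
  robinConst_le_contact stub_feshbachIdentities hω hl hβ hγ hT h

/-- `RobinCoercivity` can only hold with a constant `c ≤ γT²` (unconditional). -/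
theorem robinCoercivity_const_le' (hRC : RobinCoercivity) {ω₂ lam β γ T : ℝ} (hω : 0 < ω₂) (hl : 0 < lam)
    (hβ : 0 < β) (hγ : 0 < γ) (hT : 0 < T) : ∃ c : ℝ, 0 < c ∧ c ≤ γ * T ^ 2 ∧ RobinCoercivityAt ω₂ lam β γ T c :=
  robinCoercivity_const_le stub_feshbachIdentities hRC hω hl hβ hγ hT

/-- **No `T`-uniform Robin constant** (unconditional). -/
theorem not_robinCoercivityUniformInT' : ¬ RobinCoercivityUniformInT :=
  not_robinCoercivityUniformInT stub_feshbachIdentities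

/-- **No `γ`-uniform Robin constant** (unconditional). -/
theorem not_robinCoercivityUniformInCoupling' : ¬ RobinCoercivityUniformInCoupling :=
  not_robinCoercivityUniformInCoupling stub_feshbachIdentities

/-- **No uniform `ℓ²`-ellipticity of the Feshbach matrix** (unconditional). -/
theorem not_uniformL2Ellipticity' : ¬ UniformL2Ellipticity :=
  not_uniformL2Ellipticity stub_feshbachIdentities

end Unconditional

end Summit.AtomisticToContinuum.FouriersLaw.Theorems.RobinCoercivity.Negative

end
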